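import Summits.QuantumAdvantage.QuantumAdvantage.Theorems.SosSandwichPseudoBoundedAABlockSymmetricCorner
import HarnessLib

/-!
# Crux `PseudoBoundedAA` (stmt-QuantumAdvantage-15237) / `AAConj` (10748) — block-symmetric bounded polynomials of
# low degree have SMALL VARIANCE when all blocks are large: `Var[p] · min_j |B_j| ≤ 256 d² m`

Companion to `Theorems/SosSandwichPseudoBoundedAABlockSymmetricCorner.lean`.  The tree's sharp symmetric corner rests on
`Var[p]·n ≤ 256 d²` for weight-symmetric `[0,1]`-bounded `p` of degree `≤ d` on `n` bits
(`SymmetricCorner.boolVariance_mul_card_le_of_symmetric`: a bounded low-degree function of ONE weight is nearly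
constant).  With the Efron–Stein block decomposition of part 1 (`fvar_le_sum_condVar`,
`boolVariance_blockRestrict`) this globalises to polynomials symmetric inside each of `m` blocks `B_j = blk⁻¹(j)`:

  `Var[p] ≤ Σ_j E_y Var[p|_{B_j,y}] ≤ Σ_j 256 d²/|B_j| ≤ 256 d² m / n₀`   whenever every `|B_j| ≥ n₀ ≥ 1`

(`boolVariance_mul_le_of_blockSymmetric`), i.e. a `[0,1]`-bounded polynomial of degree `≤ d` in the `m` block weights
has variance `≤ 256 d² m / n₀` — coarse statistics of large blocks are concentrated, uniformly in `N`.  For `m = 1`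
this is the tree's bound; it is the mechanism behind the block-symmetric corner (there used fibrewise).
Elementary; no named facts; objects inline.  Honest label: support lemma for an open conjecture, nothing closed.
[cite: AaronsonAmbainis2014, Conj. 6] [cite: ODonnell2014, §3.3] [cite: Rivlin1974, Sect. 2.7 Remark 2 (2.44)-(2.45)]
-/

-- D-0017: single-conjunct summit ⇒ the duplicate `QuantumAdvantage.QuantumAdvantage` is mandated.
set_option linter.dupNamespace false

noncomputable section

open Finset MvPolynomial
open Literature.Computability.QuantumComplexity

namespace Summit.QuantumAdvantage.QuantumAdvantage.Theorems.SosSandwich.BlockSymmetricCorner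

variable {N : ℕ}

/-- **Block-symmetric bounded polynomials of low degree have small variance when all blocks are large.**  If `p` has
total degree `≤ d`, is `[0,1]`-valued on the cube and its cube values depend only on the weights inside the blocks
`B_j = blk⁻¹(j)` (`j < m`), and every block has at least `n₀ ≥ 1` variables, then `Var[p] · n₀ ≤ 256 d² m`.
[cite: AaronsonAmbainis2014, Conj. 6] [cite: ODonnell2014, §3.3] [cite: Rivlin1974, Sect. 2.7 Remark 2 (2.44)-(2.45)] -/
theorem boolVariance_mul_le_of_blockSymmetric {m d n₀ : ℕ} (blk : Fin N → Fin m) (p : MvPolynomial (Fin N) ℝ)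
    (hdeg : p.totalDegree ≤ d) (hb : ∀ x, 0 ≤ evalBool p x ∧ evalBool p x ≤ 1)
    (hsym : ∀ x x' : Fin N → Bool,
      (∀ j : Fin m, (univ.filter fun i => blk i = j ∧ x i = true).card =
        (univ.filter fun i => blk i = j ∧ x' i = true).card) → evalBool p x = evalBool p x')
    (hn₀ : 0 < n₀) (hsize : ∀ j : Fin m, n₀ ≤ (univ.filter fun i => blk i = j).card) :
    boolVariance p * n₀ ≤ 256 * (d : ℝ) ^ 2 * m := by
  have hn0 : (0 : ℝ) < (n₀ : ℝ) := by exact_mod_cast hn₀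
  -- Efron–Stein over the blocks
  have hES := fvar_le_sum_condVar blk (evalBool p)
  change boolVariance p ≤ _ at hES
  -- each block term is at most `256 d² / n₀`
  have hblock : ∀ j : Fin m,
      boolAvg (fun y => boolAvg (fun x => (evalBool p ((univ.filter fun i => blk i = j)ᶜ.piecewise y x) - boolAvg (fun x => evalBool p ((univ.filter fun i => blk i = j)ᶜ.piecewise y x))) ^ 2)) ≤
        256 * (d : ℝ) ^ 2 / n₀ := by
    intro j
    have hn : 0 < (univ.filter fun i => blk i = j).card := lt_of_lt_of_le hn₀ (hsize j)
    have hnR : (0 : ℝ) < ((univ.filter fun i => blk i = j).card : ℝ) := by exact_mod_cast hn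
    -- fibrewise: the block restriction is weight-symmetric, bounded, of degree `≤ d`
    have hy : ∀ y : Fin N → Bool,
        boolAvg (fun x => (evalBool p ((univ.filter fun i => blk i = j)ᶜ.piecewise y x) - boolAvg (fun x => evalBool p ((univ.filter fun i => blk i = j)ᶜ.piecewise y x))) ^ 2) ≤
          256 * (d : ℝ) ^ 2 / n₀ := by
      intro y
      rw [← boolVariance_blockRestrict]
      have hV := SymmetricCorner.boolVariance_mul_card_le_of_symmetric
        (bind₁ (fun i => if h : i ∈ (univ.filter fun i => blk i = j) then X ((univ.filter fun i => blk i = j).equivFin ⟨i, h⟩) else C (if y i then (1 : ℝ) else 0)) p)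
        ((totalDegree_blockRestrict_le _ y p).trans hdeg)
        (fun z z' hzz => blockRestrict_symmetric blk p hsym j _ (fun i => by simp) y z z' hzz)
        (fun z => by rw [evalBool_blockRestrict]; exact hb _) hn
      rw [le_div_iff₀ hn0]
      calc boolVariance (bind₁ (fun i => if h : i ∈ (univ.filter fun i => blk i = j) then X ((univ.filter fun i => blk i = j).equivFin ⟨i, h⟩) else C (if y i then (1 : ℝ) else 0)) p) * n₀
          ≤ boolVariance (bind₁ (fun i => if h : i ∈ (univ.filter fun i => blk i = j) then X ((univ.filter fun i => blk i = j).equivFin ⟨i, h⟩) else C (if y i then (1 : ℝ) else 0)) p) *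
              ((univ.filter fun i => blk i = j).card : ℝ) :=
            mul_le_mul_of_nonneg_left (by exact_mod_cast hsize j) (boolVariance_nonneg _)
        _ ≤ 256 * (d : ℝ) ^ 2 := hV
    calc boolAvg (fun y => boolAvg (fun x => (evalBool p ((univ.filter fun i => blk i = j)ᶜ.piecewise y x) - boolAvg (fun x => evalBool p ((univ.filter fun i => blk i = j)ᶜ.piecewise y x))) ^ 2))
        ≤ boolAvg (fun _ : Fin N → Bool => 256 * (d : ℝ) ^ 2 / n₀) := boolAvg_mono hy
      _ = 256 * (d : ℝ) ^ 2 / n₀ := boolAvg_const _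
  have hsum : boolVariance p ≤ (m : ℝ) * (256 * (d : ℝ) ^ 2 / n₀) := by
    refine hES.trans ?_
    calc ∑ j : Fin m, boolAvg (fun y => boolAvg (fun x => (evalBool p ((univ.filter fun i => blk i = j)ᶜ.piecewise y x) - boolAvg (fun x => evalBool p ((univ.filter fun i => blk i = j)ᶜ.piecewise y x))) ^ 2))
        ≤ ∑ _j : Fin m, 256 * (d : ℝ) ^ 2 / n₀ := Finset.sum_le_sum fun j _ => hblock j
      _ = (m : ℝ) * (256 * (d : ℝ) ^ 2 / n₀) := by
          rw [Finset.sum_const, Finset.card_univ, Fintype.card_fin, nsmul_eq_mul]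
  rw [← le_div_iff₀ hn0]
  calc boolVariance p ≤ (m : ℝ) * (256 * (d : ℝ) ^ 2 / n₀) := hsum
    _ = 256 * (d : ℝ) ^ 2 * m / n₀ := by ring

/-- **Contrapositive, route reading**: a block-symmetric `[0,1]`-bounded `p` of degree `≤ d` with `Var[p] ≥ ε` has a
block with fewer than `256 d² m/ε + 1` variables — on that block the influences of `p` add up, which is where the
block-symmetric corner (`exists_influence_ge_of_blockSymmetric`, part 2/2) finds its influential variable.
[cite: AaronsonAmbainis2014, Conj. 6] -/
theorem exists_small_block_of_variance {m d : ℕ} (blk : Fin N → Fin m) (p : MvPolynomial (Fin N) ℝ)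
    (hdeg : p.totalDegree ≤ d) (hb : ∀ x, 0 ≤ evalBool p x ∧ evalBool p x ≤ 1)
    (hsym : ∀ x x' : Fin N → Bool,
      (∀ j : Fin m, (univ.filter fun i => blk i = j ∧ x i = true).card =
        (univ.filter fun i => blk i = j ∧ x' i = true).card) → evalBool p x = evalBool p x')
    {ε : ℝ} (hεV : ε ≤ boolVariance p) (hm : 0 < m) :
    ∃ j : Fin m, (((univ.filter fun i => blk i = j).card : ℕ) : ℝ) * ε ≤ 256 * (d : ℝ) ^ 2 * m := by
  by_contra hcon
  push Not at hcon
  -- every block is large: `|B_j| > 256 d² m / ε`; take `n₀ = min_j |B_j|`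
  have hne : (Finset.univ : Finset (Fin m)).Nonempty := Finset.univ_nonempty_iff.mpr ⟨⟨0, hm⟩⟩
  obtain ⟨j₀, -, hj₀⟩ :=
    Finset.exists_min_image Finset.univ (fun j : Fin m => (univ.filter fun i => blk i = j).card) hne
  have hlt := hcon j₀
  have hn₀ : 0 < (univ.filter fun i => blk i = j₀).card := by
    rcases Nat.eq_zero_or_pos ((univ.filter fun i => blk i = j₀).card) with h0 | hpos
    · exfalso
      rw [h0] at hlt
      simp only [Nat.cast_zero, zero_mul] at hlt
      have : (0 : ℝ) ≤ 256 * (d : ℝ) ^ 2 * m := by positivity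
      linarith
    · exact hpos
  have hV := boolVariance_mul_le_of_blockSymmetric blk p hdeg hb hsym hn₀ (fun j => hj₀ j (Finset.mem_univ j))
  have hn0 : (0 : ℝ) ≤ (((univ.filter fun i => blk i = j₀).card : ℕ) : ℝ) := by positivity
  have hmul : (((univ.filter fun i => blk i = j₀).card : ℕ) : ℝ) * ε ≤
      boolVariance p * (((univ.filter fun i => blk i = j₀).card : ℕ) : ℝ) := by
    nlinarith [hεV, hn0]
  linarith

end Summit.QuantumAdvantage.QuantumAdvantage.Theorems.SosSandwich.BlockSymmetricCorner

end
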